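import Literature.AnabelianGeometry.AbsoluteAnabelian.AbsTopII.DehnTwistEdgeTorusCentralizerCases
import Literature.GroupTheory.LevelwiseConjugacyLimit
import HarnessLib

/-!
# A model of the [EtTh] §1 root: level-wise conjugacy INTO the closed family `{g b^t g⁻¹}` of `F̂₂`
# ⇒ membership (compactness), and the centraliser of a conjugate of a non-trivial `b`-power

Mochizuki, *The étale theta function …*, Publ. RIMS **45** (2009) [EtTh], §1, PRIMS PDF p. 12 («`Δ_X` … a
profinite free group on 2 generators») [cite: MochizukiEtTh2009, §1 p.12] — the model `F̂₂ = F₂hatT` of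
abc-iut-L2-t1 (`SettingModelFreeGroup`), its `b`-powers `bPow : Ẑ →ₜ* F̂₂` (abc-iut-w5-d024, `SettingModelChiTwist`)
and `b`-axis `bAxis = b^Ẑ` (abc-iut-L2-t1, `SettingModelCuspAxis`); the malnormality of `b^Ẑ` in the form
`DehnTwist.mem_nodeGp_of_commute_bPow` (abc-iut-f-069, `AbsTopII/DehnTwistEdgeTorusCentralizerCases`); the
Cantor-intersection pattern of `Literature/GroupTheory/LevelwiseConjugacyLimit.lean` (Ribes–Zalesskii, *Profinite
Groups*, Thm 2.1.3: open normal subgroups of a profinite group are a neighbourhood basis of `1` with trivial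
intersection) [cite: RibesZalesskii2010, Thm 2.1.3].  All consumed BY NAME; nothing of another seat is restated.

PROOF-ONLY file (no definition, no instance, no notation), abc-iut cell layer L6, seat abc-iut-w5-d169 (gen 15),
row PL2-LEAF-1 of abc-iut-L6-lead, leaves (Cp) and (HR′) of programme P-L2, rung (L2-T):

* GENERAL (any topological group `G`, any compact parameter space `P`, any continuous family `F : P → G`):
  `exists_eq_of_levelwise_mem` — if for every member `N_i` of a directed separating family of OPEN subgroups some
  `F p` satisfies `w⁻¹ F(p) ∈ N_i`, then `w = F p` for some `p` (the sets `{p | w⁻¹ F p ∈ N_i}` are closed,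
  non-empty, `⊇`-directed in the compact `P`); profinite forms over ALL open normal subgroups
  (`exists_eq_of_forall_openNormalSubgroup`) and over any COFINAL family of them (`exists_eq_of_cofinal`); the
  conjugacy-family instance `F(g, t) = g φ(t) g⁻¹` on `P = G × T` (`exists_eq_conj_of_forall_openNormalSubgroup`).
* MODEL, (Cp): **`exists_eq_conj_bPow_of_forall_openNormalSubgroup`** — `w ∈ F̂₂` congruent modulo every open
  normal `N` to a conjugate of a `b`-power is itself `g b^t g⁻¹` (`g ∈ F̂₂`, `t ∈ Ẑ`); cofinal-family form
  `exists_eq_conj_bPow_of_cofinal`; finite-quotient form **`exists_eq_conj_bPow_of_forall_quotient`** (at every level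
  `F̂₂/N` the image of `w` is conjugate INTO the cyclic group generated by the image of `b`).
* MODEL, (HR′): **`exists_eq_conj_bPow_of_commute`** — an element commuting with `g b^u g⁻¹`, `b^u ≠ 1`, is
  `g b^s g⁻¹`; `centralizer_conj_bPow_eq` — `C_{F̂₂}(g b^u g⁻¹) = g b^Ẑ g⁻¹`; `isClosed_conj_bAxis`.
Classical profinite group theory at OUR semi-synthetic model; nothing of [EtTh] is asserted; no side is taken on
[IUTchIII] Cor. 3.12; typed ≠ proved ≠ print.
-/

noncomputable section

open scoped Pointwise

namespace Literature.AnabelianGeometry.EtaleTheta.SettingModel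

open Literature.AnabelianGeometry.AbsoluteAnabelian.AbsTopII
open _root_.Topology

/-! ### Level-wise membership in a compact family ⇒ membership -/

section General

variable {G : Type*} [Group G] [TopologicalSpace G] [IsTopologicalGroup G]
variable {P : Type*} [TopologicalSpace P] [CompactSpace P]

/-- **Level-wise in a compact family ⇒ in the family.**  `G` a topological group, `N : ι → Subgroup G` OPEN
subgroups, directed under reverse inclusion and separating points; `F : P → G` continuous on a COMPACT space `P`.
If at every level `i` some `p` has `w⁻¹ · F(p) ∈ N i`, then `w = F(p)` for some `p` (Cantor intersection of the
closed non-empty `⊇`-directed sets `{p | w⁻¹ F p ∈ N i}`). [cite: RibesZalesskii2010, Thm 2.1.3] -/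
theorem exists_eq_of_levelwise_mem {ι : Type*} [Nonempty ι] (N : ι → Subgroup G)
    (hopen : ∀ i, IsOpen (N i : Set G)) (hdir : Directed (· ≥ ·) N)
    (hsep : ∀ x : G, (∀ i, x ∈ N i) → x = 1) {F : P → G} (hF : Continuous F) (w : G)
    (hlev : ∀ i, ∃ p, w⁻¹ * F p ∈ N i) : ∃ p, w = F p := by
  let C : ι → Set P := fun i => {p | w⁻¹ * F p ∈ N i}
  have hCdir : Directed (· ⊇ ·) C := by
    intro i j
    obtain ⟨l, hli, hlj⟩ := hdir i j
    exact ⟨l, fun p hp => hli hp, fun p hp => hlj hp⟩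
  have hCne : ∀ i, (C i).Nonempty := fun i => hlev i
  have hCcl : ∀ i, IsClosed (C i) := fun i =>
    ((N i).isClosed_of_isOpen (hopen i)).preimage (continuous_const.mul hF)
  obtain ⟨p, hp⟩ := IsCompact.nonempty_iInter_of_directed_nonempty_isCompact_isClosed C hCdir hCne
    (fun i => (hCcl i).isCompact) hCcl
  exact ⟨p, inv_mul_eq_one.mp (hsep _ fun i => Set.mem_iInter.mp hp i)⟩

variable [CompactSpace G] [TotallyDisconnectedSpace G] [T2Space G]

/-- **Profinite form**: `G` profinite, `F : P → G` continuous on a compact `P`; if `w` is congruent to some `F(p)`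
modulo EVERY open normal subgroup, then `w = F(p)` for some `p`. [cite: RibesZalesskii2010, Thm 2.1.3] -/
theorem exists_eq_of_forall_openNormalSubgroup {F : P → G} (hF : Continuous F) (w : G)
    (hlev : ∀ N : OpenNormalSubgroup G, ∃ p, w⁻¹ * F p ∈ N) : ∃ p, w = F p := by
  haveI : Nonempty (OpenNormalSubgroup G) :=
    ⟨{ toOpenSubgroup := ⊤, isNormal' := by change (⊤ : Subgroup G).Normal; infer_instance }⟩
  refine exists_eq_of_levelwise_mem (fun N : OpenNormalSubgroup G => (N : Subgroup G)) (fun N => N.isOpen) ?_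
    (fun x hx => Literature.GroupTheory.LevelwiseConjugacyLimit.eq_one_of_forall_mem_openNormalSubgroup x hx)
    hF w hlev
  intro N N'
  exact ⟨N ⊓ N', inf_le_left, inf_le_right⟩

/-- **Cofinal-family form**: it suffices to test the congruences on any COFINAL family `fam` of open normal
subgroups (every open normal subgroup contains a member of `fam`). [cite: RibesZalesskii2010, Thm 2.1.3] -/
theorem exists_eq_of_cofinal {F : P → G} (hF : Continuous F) (w : G) (fam : Set (OpenNormalSubgroup G))
    (hcof : ∀ N : OpenNormalSubgroup G, ∃ M ∈ fam, (M : Subgroup G) ≤ N)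
    (hlev : ∀ M ∈ fam, ∃ p, w⁻¹ * F p ∈ M) : ∃ p, w = F p :=
  exists_eq_of_forall_openNormalSubgroup hF w fun N => by
    obtain ⟨M, hM, hMN⟩ := hcof N
    obtain ⟨p, hp⟩ := hlev M hM
    exact ⟨p, hMN hp⟩

/-- **Level-wise conjugacy INTO a compact family ⇒ conjugacy into it.**  `G` profinite, `φ : T → G` continuous on
a compact `T` (a closed family of elements, e.g. a closed procyclic subgroup); if modulo every open normal `N` the
element `w` is congruent to a conjugate `g φ(t) g⁻¹`, then `w = g φ(t) g⁻¹` for some `g ∈ G`, `t ∈ T`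
(the instance `P = G × T`, `F(g,t) = g φ(t) g⁻¹`). [cite: RibesZalesskii2010, Thm 2.1.3] -/
theorem exists_eq_conj_of_forall_openNormalSubgroup {T : Type*} [TopologicalSpace T] [CompactSpace T]
    {φ : T → G} (hφ : Continuous φ) (w : G)
    (hlev : ∀ N : OpenNormalSubgroup G, ∃ (g : G) (t : T), w⁻¹ * (g * φ t * g⁻¹) ∈ N) :
    ∃ (g : G) (t : T), w = g * φ t * g⁻¹ := by
  obtain ⟨⟨g, t⟩, h⟩ := exists_eq_of_forall_openNormalSubgroup (P := G × T)
    (F := fun p => p.1 * φ p.2 * p.1⁻¹)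
    ((continuous_fst.mul (hφ.comp continuous_snd)).mul continuous_fst.inv) w
    fun N => by
      obtain ⟨g, t, hgt⟩ := hlev N
      exact ⟨(g, t), hgt⟩
  exact ⟨g, t, h⟩

end General

/-! ### The model: the closed family `C = {g b^t g⁻¹}` of `F̂₂` -/

open Literature.AnabelianGeometry.SemiGraphs

/-- **(Cp)** In `F̂₂`: if modulo every open normal subgroup `N` the element `w` is congruent to a conjugate of a
`b`-power, `w⁻¹ · g b^t g⁻¹ ∈ N`, then `w = g b^t g⁻¹` for some `g ∈ F̂₂`, `t ∈ Ẑ` (the sets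
`S_N = {(g,t) | w⁻¹ g b^t g⁻¹ ∈ N}` are closed, non-empty and decreasing in the compact `F̂₂ × Ẑ`, and
`⋂_N N = 1`). [cite: MochizukiEtTh2009, §1 p.12] -/
theorem exists_eq_conj_bPow_of_forall_openNormalSubgroup (w : F₂hatT)
    (h : ∀ N : OpenNormalSubgroup F₂hatT, ∃ (g : F₂hatT) (t : ZH), w⁻¹ * (g * bPow t * g⁻¹) ∈ N) :
    ∃ (g : F₂hatT) (t : ZH), w = g * bPow t * g⁻¹ :=
  exists_eq_conj_of_forall_openNormalSubgroup bPow.continuous w h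

/-- **(Cp), cofinal levels**: the same with the congruences tested only on a COFINAL family of open normal
subgroups of `F̂₂`. [cite: MochizukiEtTh2009, §1 p.12] -/
theorem exists_eq_conj_bPow_of_cofinal (w : F₂hatT) (fam : Set (OpenNormalSubgroup F₂hatT))
    (hcof : ∀ N : OpenNormalSubgroup F₂hatT, ∃ M ∈ fam, (M : Subgroup F₂hatT) ≤ N)
    (h : ∀ M ∈ fam, ∃ (g : F₂hatT) (t : ZH), w⁻¹ * (g * bPow t * g⁻¹) ∈ M) :
    ∃ (g : F₂hatT) (t : ZH), w = g * bPow t * g⁻¹ :=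
  exists_eq_conj_bPow_of_forall_openNormalSubgroup w fun N => by
    obtain ⟨M, hM, hMN⟩ := hcof N
    obtain ⟨g, t, hgt⟩ := h M hM
    exact ⟨g, t, hMN hgt⟩

/-- **(Cp), finite-quotient spelling**: if at every level `F̂₂/N` (`N` open normal) the image of `w` is conjugate
INTO the cyclic subgroup generated by the image of `b = η x₁`, then `w = g b^t g⁻¹` for some `g ∈ F̂₂`, `t ∈ Ẑ`
(the level conjugator lifts to `F̂₂` since `F̂₂ → F̂₂/N` is onto; `b^n = bPow (ι n)`).
[cite: MochizukiEtTh2009, §1 p.12] -/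
theorem exists_eq_conj_bPow_of_forall_quotient (w : F₂hatT)
    (h : ∀ N : OpenNormalSubgroup F₂hatT, ∃ (γ : F₂hatT ⧸ (N : Subgroup F₂hatT)) (n : ℕ),
      (QuotientGroup.mk w : F₂hatT ⧸ (N : Subgroup F₂hatT)) =
        γ * QuotientGroup.mk (eta (FreeGroup.of 1)) ^ n * γ⁻¹) :
    ∃ (g : F₂hatT) (t : ZH), w = g * bPow t * g⁻¹ := by
  refine exists_eq_conj_bPow_of_forall_openNormalSubgroup w fun N => ?_
  obtain ⟨γ, n, hγ⟩ := h N
  obtain ⟨g, rfl⟩ := QuotientGroup.mk_surjective γ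
  refine ⟨g, iotaZ (Multiplicative.ofAdd (n : ℤ)), QuotientGroup.eq.mp ?_⟩
  rw [hγ, bPow_iotaZ, toAdd_ofAdd, zpow_natCast, QuotientGroup.mk_mul, QuotientGroup.mk_mul,
    QuotientGroup.mk_pow, QuotientGroup.mk_inv]

/-! ### (HR′) The centraliser of a conjugate of a non-trivial `b`-power -/

/-- **(HR′)** An element of `F̂₂` commuting with `g b^u g⁻¹`, `b^u ≠ 1`, lies in `g b^Ẑ g⁻¹`: it is `g b^s g⁻¹`
for some `s ∈ Ẑ` (malnormality of `b^Ẑ`, via `DehnTwist.mem_nodeGp_of_commute_bPow` applied to `g⁻¹ x g`).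
[cite: MochizukiEtTh2009, §1 p.12] -/
theorem exists_eq_conj_bPow_of_commute (g : F₂hatT) {u : ZH} (hu : bPow u ≠ 1) {x : F₂hatT}
    (h : x * (g * bPow u * g⁻¹) = g * bPow u * g⁻¹ * x) : ∃ s : ZH, x = g * bPow s * g⁻¹ := by
  have hy : g⁻¹ * x * g * bPow u = bPow u * (g⁻¹ * x * g) := by
    calc g⁻¹ * x * g * bPow u = g⁻¹ * (x * (g * bPow u * g⁻¹)) * g := by group
      _ = g⁻¹ * (g * bPow u * g⁻¹ * x) * g := by rw [h]
      _ = bPow u * (g⁻¹ * x * g) := by group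
  obtain ⟨s, hs⟩ := (mem_bAxis_iff _).mp
    (show g⁻¹ * x * g ∈ bAxis from DehnTwist.mem_nodeGp_of_commute_bPow hu hy)
  exact ⟨s, by rw [hs]; group⟩

/-- The conjugate `g b^Ẑ g⁻¹` of the `b`-axis is closed in `F̂₂`. [cite: MochizukiEtTh2009, §1 p.12] -/
theorem isClosed_conj_bAxis (g : F₂hatT) :
    IsClosed ((MulAut.conj g • bAxis : Subgroup F₂hatT) : Set F₂hatT) := by
  rw [Subgroup.coe_pointwise_smul, ← Set.image_smul]
  refine (isClosed_bAxis.isCompact.image ?_).isClosed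
  simp only [MulAut.smul_def, MulAut.conj_apply]
  exact (continuous_const.mul continuous_id).mul continuous_const

/-- **(HR′), subgroup form**: `C_{F̂₂}(g b^u g⁻¹) = g b^Ẑ g⁻¹` for `b^u ≠ 1`. [cite: MochizukiEtTh2009, §1 p.12] -/
theorem centralizer_conj_bPow_eq (g : F₂hatT) {u : ZH} (hu : bPow u ≠ 1) :
    Subgroup.centralizer ({g * bPow u * g⁻¹} : Set F₂hatT) = MulAut.conj g • bAxis := by
  ext x
  rw [Subgroup.mem_centralizer_singleton_iff, Subgroup.mem_smul_pointwise_iff_exists]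
  constructor
  · intro hx
    obtain ⟨s, rfl⟩ := exists_eq_conj_bPow_of_commute g hu hx
    exact ⟨bPow s, bPow_mem_bAxis s, by rw [MulAut.smul_def, MulAut.conj_apply]⟩
  · rintro ⟨y, hy, rfl⟩
    obtain ⟨s, rfl⟩ := (mem_bAxis_iff _).mp hy
    rw [MulAut.smul_def, MulAut.conj_apply]
    have hc : bPow s * bPow u = bPow u * bPow s :=
      DehnTwist.commute_of_mem_bAxis (bPow_mem_bAxis s) (bPow_mem_bAxis u)
    calc g * bPow s * g⁻¹ * (g * bPow u * g⁻¹) = g * (bPow s * bPow u) * g⁻¹ := by group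
      _ = g * (bPow u * bPow s) * g⁻¹ := by rw [hc]
      _ = g * bPow u * g⁻¹ * (g * bPow s * g⁻¹) := by group

end Literature.AnabelianGeometry.EtaleTheta.SettingModel

end
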